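import Mathlib.GroupTheory.Index
import Mathlib.Tactic.Group

/-!
# Route LinearSystemTorelli — crux `LocalTubeSpan` (stmt-HodgeConjecture-2490): index bookkeeping for the frame lift

Helper file (`--supports stmt-HodgeConjecture-2490`, line `Sketch` of the crux chain, cycle 6
"Schnell's Lemma 11 for degenerate lattices from the nondegenerate case", stub
`stub_indexBookkeeping`).

The line reduces the crux ("local Schnell theorem", C. Schnell, *Primitive cohomology and the tube
mapping*, Math. Z. 268 (2010) §3, §7) to Schnell's Lemma 11 (a finite-index "frame" subgroup of
the monodromy group `Γ_Δ` of a skew vanishing lattice).  Cycle 6 proves Lemma 11 for DEGENERATE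
lattices from the nondegenerate case: the frame group `H = Γ'` meets the (abelian, normalised by
`K = Γ_Δ`) unipotent subgroup `N = U_Γ` with finite index, and `K` is covered by finitely many
translates `c · H · N` coming from the nondegenerate quotient lattice.  This file is the pure group
theory concluding `[K : H] < ∞`:

* `localTubeSpan_indexBookkeeping` — for subgroups `H, N ≤ K` of a group `G` with `N` normalised by
  `K`, if `K ⊆ ⋃_{c ∈ C} c · H · N` for a finite set `C ⊆ K` and `H ∩ N` has finite index in `N`,
  then `H` has finite index in `K`.

Proof (coset counting, no quotient groups): for `g = c h n ∈ K` one has `g = c n' h` with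
`n' = h n h⁻¹ ∈ N` (`h ∈ H ≤ K` normalises `N`), so the left coset `g H` is `c n' H`, and `n' H`
only depends on the coset `n' (H ∩ N)`; hence `C × N ⧸ (H ∩ N) → K ⧸ H`, `(c, n̄) ↦ c n H`
(Mathlib's `Subgroup.quotientSubgroupOfEmbeddingOfLE` followed by the left action of `c`) is a
surjection from a finite type.  Mathlib only (`Subgroup.FiniteIndex`, `QuotientGroup`,
`MulAction.Quotient.smul_mk`); no named facts, no `sorry`.
-/

-- `Summit.HodgeConjecture.HodgeConjecture.Theorems` is the mandated namespace (single-conjunct summit: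
-- Sub = Summit), which `linter.dupNamespace` flags on every declaration; the lakefile turns the
-- linter off tree-wide (weak option), restated here so stand-alone elaboration is warning-free too.
set_option linter.dupNamespace false

namespace Summit.HodgeConjecture.HodgeConjecture.Theorems

/-- **Index bookkeeping** (stub `stub_indexBookkeeping` of the line `Sketch`, pure group theory).
For subgroups `H, N ≤ K` of a group `G` with `N` normalised by `K`: if `K` is covered by the
finitely many translates `c · H · N`, `c ∈ C ⊆ K`, and `H ∩ N` has finite index in `N`, then `H`
has finite index in `K` — the map `C × N ⧸ (H ∩ N) → K ⧸ H`, `(c, n̄) ↦ c n H`, is a surjection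
from a finite type (`c h n = c (h n h⁻¹) h`). [folklore] -/
theorem localTubeSpan_indexBookkeeping {G : Type*} [Group G] (K H N : Subgroup G) (hH : H ≤ K)
    (hN : N ≤ K) (hnorm : ∀ k ∈ K, ∀ n ∈ N, k * n * k⁻¹ ∈ N)
    (C : Finset G) (hCK : ∀ c ∈ C, c ∈ K)
    (hC : ∀ g ∈ K, ∃ c ∈ C, ∃ h ∈ H, ∃ n ∈ N, g = c * h * n)
    (h2 : ((H ⊓ N).subgroupOf N).FiniteIndex) :
    (H.subgroupOf K).FiniteIndex := by
  haveI : (H.subgroupOf N).FiniteIndex := by rwa [Subgroup.inf_subgroupOf_right] at h2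
  -- the coset map `(c, n (H ∩ N)) ↦ c n H`
  let f : C × (N ⧸ H.subgroupOf N) → K ⧸ H.subgroupOf K := fun p =>
    (⟨(p.1 : G), hCK _ p.1.2⟩ : K) • Subgroup.quotientSubgroupOfEmbeddingOfLE H hN p.2
  have hf : Function.Surjective f := by
    intro x
    induction x using QuotientGroup.induction_on with
    | H g =>
      obtain ⟨c, hc, h, hh, n, hn, hg⟩ := hC g g.2
      have hn' : h * n * h⁻¹ ∈ N := hnorm h (hH hh) n hn
      refine ⟨(⟨c, hc⟩, QuotientGroup.mk ⟨h * n * h⁻¹, hn'⟩), ?_⟩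
      simp only [f, Subgroup.quotientSubgroupOfEmbeddingOfLE_apply_mk, MulAction.Quotient.smul_mk,
        smul_eq_mul]
      refine QuotientGroup.eq.mpr ?_
      rw [Subgroup.mem_subgroupOf]
      have key : (((⟨c, hCK c hc⟩ * Subgroup.inclusion hN ⟨h * n * h⁻¹, hn'⟩)⁻¹ * g : K) : G) = h := by
        simp only [Subgroup.coe_mul, Subgroup.coe_inv, Subgroup.coe_inclusion, hg]
        group
      rw [key]
      exact hh
  haveI : Finite (K ⧸ H.subgroupOf K) := Finite.of_surjective f hf
  exact Subgroup.finiteIndex_of_finite_quotient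

end Summit.HodgeConjecture.HodgeConjecture.Theorems
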